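import Literature.AlgebraicGeometry.HodgeTheory.CycleClassPushforward
import Literature.AlgebraicGeometry.Resolution.EtaleOverNhd
import Literature.AlgebraicGeometry.Resolution.EtaleNhdOfFlatUnramifiedPoint
import Mathlib.RingTheory.Unramified.Field
import Mathlib.FieldTheory.Perfect
import HarnessLib

/-!
# Generic étaleness of a morphism of finite degree between smooth projective varieties over `ℂ`

Family `hodge`, layer `Literature/AlgebraicGeometry/HodgeTheory`. Let `q : T ⟶ W` be a morphism of
smooth projective `d`-folds over `ℂ` with `q_*[T] = k • [W]` as cycles, `k ≥ 1` (Fulton,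
*Intersection Theory*, §1.4: `q` is dominant and `k = [K(T) : K(W)]`). Then `q` is **étale over a
Zariski-open neighbourhood of the generic point of `W`**
(`exists_etale_morphismRestrict_of_map_primeCycle_eq_nsmul`): this is the statement behind
"a general fibre of a generically finite morphism of degree `k` consists of `k` reduced points" in
characteristic `0` (Harris, *Algebraic Geometry*, Prop. 7.16), and is an instance of EGA IV₄,
Théorème 17.6.1 (c ⇒ a) at the generic point `θ` of `T`:

* the stalk map `q^♯_θ : 𝒪_{W, q θ} = K(W) → 𝒪_{T, θ} = K(T)` is a homomorphism of FIELDS (the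
  local rings at the generic points of the integral schemes `T`, `W`), isomorphic to the residue
  field extension `κ(q θ) → κ(θ)`, which is finite of degree `k` (the push-forward coefficient)
  and separable (characteristic `0`); hence `q^♯_θ` is flat (Mathlib `RingHom.Flat.of_isField`) and
  formally unramified (`ringHom_formallyUnramified_of_isField`,
  `ringHom_formallyUnramified_of_finite_of_charZero`, Mathlib
  `Algebra.FormallyUnramified.of_isSeparable`);
* EGA IV₄ 17.6.1 c)⇒a) (`Resolution.exists_etale_ι_comp_of_flat_of_formallyUnramified_stalkMap`)
  makes `q` étale on an open `O ∋ θ`;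
* `θ` is the only point of `T` over `q θ` (a closed map does not raise the dimension of point
  closures, `Motives.height_base_le_of_isClosedMap`, and the generic point is the only point of
  dimension `d`), so, `q` being closed, `q` is étale over `W ∖ q(T ∖ O) ∋ q θ`
  (`Resolution.exists_etale_morphismRestrict_of_forall_exists_opens`).

## References

* [Grothendieck1967] A. Grothendieck, J. Dieudonné, EGA IV₄, Publ. Math. IHÉS 32 (1967),
  Thm. 17.6.1.
* [Harris1992] J. Harris, Algebraic Geometry: A First Course, GTM 133, Springer 1992, Prop. 7.16.
* [Fulton1998] W. Fulton, Intersection Theory, 2nd ed., Springer 1998, §1.4.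
-/

noncomputable section

open CategoryTheory CategoryTheory.Limits AlgebraicGeometry Order

namespace Literature.AlgebraicGeometry.HodgeTheory

section LocalAlgebra

/-! ### Local algebra: homomorphisms between local rings which are fields -/

universe u v

/-- A local homomorphism `φ : A → B` between local rings which are fields is formally unramified as
soon as the induced homomorphism of residue fields is: `φ` is isomorphic to the latter through the
(bijective) residue maps. [folklore] -/
theorem ringHom_formallyUnramified_of_isField {A : Type u} {B : Type v} [CommRing A] [CommRing B]
    [IsLocalRing A] [IsLocalRing B] (φ : A →+* B) [IsLocalHom φ] (hA : IsField A) (hB : IsField B)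
    (hφ : (IsLocalRing.ResidueField.map φ).FormallyUnramified) : φ.FormallyUnramified := by
  have hbijA : Function.Bijective (IsLocalRing.residue A) :=
    ⟨by
      rw [RingHom.injective_iff_ker_eq_bot, IsLocalRing.ker_residue]
      exact (IsLocalRing.isField_iff_maximalIdeal_eq).mp hA,
    IsLocalRing.residue_surjective⟩
  have hbijB : Function.Bijective (IsLocalRing.residue B) :=
    ⟨by
      rw [RingHom.injective_iff_ker_eq_bot, IsLocalRing.ker_residue]
      exact (IsLocalRing.isField_iff_maximalIdeal_eq).mp hB,
    IsLocalRing.residue_surjective⟩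
  let eB := RingEquiv.ofBijective _ hbijB
  have h1 : φ = eB.symm.toRingHom.comp ((IsLocalRing.ResidueField.map φ).comp
      (IsLocalRing.residue A)) := by
    rw [IsLocalRing.ResidueField.map_comp_residue]
    ext a
    exact (eB.symm_apply_apply (φ a)).symm
  rw [h1]
  exact RingHom.FormallyUnramified.comp (.comp (.of_surjective hbijA.2) hφ)
    (.of_surjective eB.symm.surjective)

/-- A finite extension of fields of characteristic zero is formally unramified (it is separable).
[folklore] -/
theorem ringHom_formallyUnramified_of_finite_of_charZero {K : Type u} {L : Type v} [Field K]
    [Field L] [CharZero K] (φ : K →+* L) (hφ : φ.Finite) : φ.FormallyUnramified := by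
  algebraize [φ]
  exact Algebra.FormallyUnramified.of_isSeparable K L

end LocalAlgebra

section HodgeTheory

open Literature.AlgebraicGeometry.Motives

universe u

/-- Over a locally Noetherian base, locally of finite type implies locally of finite presentation
(private copy of `AlgebraicityLocusCurves.locallyOfFinitePresentation_of_isLocallyNoetherian`, to
keep the imports light). [folklore] -/
private theorem locallyOfFinitePresentation_of_isLocallyNoetherian_aux' {X Y : Scheme.{u}}
    (g : X ⟶ Y) [IsLocallyNoetherian Y] [LocallyOfFiniteType g] :
    LocallyOfFinitePresentation g := by
  rw [HasRingHomProperty.iff_appLE (P := @LocallyOfFinitePresentation)]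
  intro U V e
  haveI := IsLocallyNoetherian.component_noetherian (X := Y) U
  exact RingHom.FinitePresentation.of_finiteType.mp
    (HasRingHomProperty.appLE @LocallyOfFiniteType g inferInstance U V e)

/-- The residue fields of a scheme over `ℂ` have characteristic zero. [folklore] -/
theorem charZero_residueField_of_schemeOver_complex (X : Motives.SchemeOver ℂ) (x : X.left) :
    CharZero (X.left.residueField x) := by
  let φ := Spec.preimage (X.left.fromSpecResidueField x ≫ X.hom)
  exact charZero_of_injective_ringHom (f := φ.hom) φ.hom.injective

/-- **Generic étaleness of a morphism of degree `k ≥ 1` between smooth projective `d`-folds over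
`ℂ`.** If `q : T ⟶ W` is a morphism of smooth projective `d`-folds over `ℂ` with
`q_*[T] = k • [W]` (`k ≥ 1`; `θ`, `ω` the generic points), then `q` is étale over an open
neighbourhood `U` of `ω`: `Etale (q ∣_ U)`. EGA IV₄ 17.6.1 c)⇒a) at `θ` — the stalk map
`K(W) → K(T)` is a finite separable extension of fields, hence flat and unramified — spread over
the base using that `θ` is the only point of `T` over `ω` and that `q` is closed.
[cite: Grothendieck1967, Thm. 17.6.1 c)⇒a)] [cite: Harris1992, Prop. 7.16] -/
theorem exists_etale_morphismRestrict_of_map_primeCycle_eq_nsmul :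
    ∀ ⦃d : ℕ⦄ ⦃T W : Motives.SchemeOver ℂ⦄ (_hT : Motives.IsSmoothProjective d T)
      (_hW : Motives.IsSmoothProjective d W) (q : T ⟶ W) [QuasiCompact q.left] ⦃θ : T.left⦄
      ⦃ω : W.left⦄, IsGenericPoint θ Set.univ → IsGenericPoint ω Set.univ → ∀ ⦃k : ℕ⦄, 0 < k →
      AlgebraicCycle.map q.left Order.height Order.height (Motives.primeCycle θ) =
        k • Motives.primeCycle ω →
      ∃ U : W.left.Opens, ω ∈ U ∧ Etale (q.left ∣_ U) := by
  intro d T W hT hW q _ θ ω hθ hω k hk hq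
  classical
  -- instances
  haveI : IsIntegral T.left := IsSmoothProjective.isIntegral_holds hT
  haveI : IsIntegral W.left := IsSmoothProjective.isIntegral_holds hW
  haveI : IsProper T.hom := IsSmoothProjective.isProper_holds hT
  haveI : IsProper W.hom := IsSmoothProjective.isProper_holds hW
  haveI : LocallyOfFiniteType T.hom := locallyOfFiniteType_of_isSmoothProjective hT
  haveI := IsSmoothProjective.isLocallyNoetherian_holds hW
  haveI : IsProper (q.left ≫ W.hom) := by
    rw [Over.w q]
    infer_instance
  haveI : IsProper q.left := IsProper.of_comp q.left W.hom
  haveI : LocallyOfFiniteType (q.left ≫ W.hom) := by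
    rw [Over.w q]
    infer_instance
  haveI : LocallyOfFiniteType q.left := locallyOfFiniteType_of_comp q.left W.hom
  haveI : LocallyOfFinitePresentation q.left :=
    locallyOfFinitePresentation_of_isLocallyNoetherian_aux' q.left
  -- (1) bookkeeping from the cycle equation: `q θ = ω`, `[κ(θ) : κ(ω)] = k`
  have hqθ : q.left.base θ = ω := base_eq_of_map_primeCycle_eq_nsmul q hk.ne' hq
  have hhθ : height θ = d := height_eq_of_isGenericPoint hT hθ
  have hhω : height ω = d := height_eq_of_isGenericPoint hW hω
  have hdeg : q.left.residueDegree θ = k := by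
    have h1 := congrArg (fun c : AlgebraicCycle W.left ℤ ↦ c ω) hq
    simp only [Motives.algebraicCycleMap_primeCycle_eq_nsmul, hqθ,
      Function.locallyFinsuppWithin.coe_nsmul, Pi.smul_apply, Motives.primeCycle_apply_self,
      nsmul_eq_mul, mul_one] at h1
    have hh : height θ = height (q.left.base θ) := by rw [hqθ, hhθ, hhω]
    simp only [AlgebraicCycle.mapCoeff, if_pos hh] at h1
    exact_mod_cast h1
  subst hqθ
  -- (2) the stalks at the generic points are fields
  have hFT : IsField (T.left.presheaf.stalk θ) :=
    isField_stalk_of_closure_mem_irreducibleComponents T.left θ (by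
      rw [hθ.def, irreducibleComponents_eq_singleton]
      exact Set.mem_singleton _)
  have hFW : IsField (W.left.presheaf.stalk (q.left.base θ)) :=
    isField_stalk_of_closure_mem_irreducibleComponents W.left (q.left.base θ) (by
      rw [hω.def, irreducibleComponents_eq_singleton]
      exact Set.mem_singleton _)
  -- (3) the stalk map is flat and formally unramified
  have hfl : (q.left.stalkMap θ).hom.Flat := RingHom.Flat.of_isField hFW _
  haveI : CharZero (W.left.residueField (q.left.base θ)) :=
    charZero_residueField_of_schemeOver_complex W _
  have hfin : (q.left.residueFieldMap θ).hom.Finite := by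
    letI := (q.left.residueFieldMap θ).hom.toAlgebra
    have : Module.Finite (W.left.residueField (q.left.base θ)) (T.left.residueField θ) :=
      Module.finite_of_finrank_pos (by
        change 0 < q.left.residueDegree θ
        rw [hdeg]
        exact hk)
    exact this
  have hur' : (q.left.residueFieldMap θ).hom.FormallyUnramified :=
    ringHom_formallyUnramified_of_finite_of_charZero _ hfin
  have hur : (q.left.stalkMap θ).hom.FormallyUnramified :=
    ringHom_formallyUnramified_of_isField _ hFW hFT hur'
  -- (4) EGA IV 17.6.1 c)⇒a): étale on an open neighbourhood of `θ`
  obtain ⟨O, hθO, hO⟩ :=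
    Resolution.exists_etale_ι_comp_of_flat_of_formallyUnramified_stalkMap q.left θ hfl hur
  -- (5) `θ` is the only point of `T` over `q θ`
  have hfib : ∀ z : T.left, q.left.base z = q.left.base θ → z = θ := by
    intro z hz
    have h1 : height (q.left.base z) ≤ height z :=
      Motives.height_base_le_of_isClosedMap q.left q.left.isClosedMap z
    rw [hz, hhω] at h1
    have hzle : z ≤ θ := Scheme.le_iff_specializes.mpr (hθ.specializes (Set.mem_univ z))
    by_contra hne
    have hlt : z < θ := lt_of_le_not_ge hzle fun hge ↦
      hne ((Scheme.le_iff_specializes.mp hge).antisymm (hθ.specializes (Set.mem_univ z))).eq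
    have h2 : height z < height θ := height_strictMono hlt
      (lt_of_le_of_lt (height_mono hzle) (by rw [hhθ]; exact ENat.coe_lt_top d))
    rw [hhθ] at h2
    exact (lt_irrefl _) (lt_of_le_of_lt h1 h2)
  -- (6) spread over the base (`q` is closed)
  exact Resolution.exists_etale_morphismRestrict_of_forall_exists_opens q.left (q.left.base θ)
    fun z hz ↦ ⟨O, (hfib z hz).symm ▸ hθO, hO⟩

end HodgeTheory

end Literature.AlgebraicGeometry.HodgeTheory

end
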